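/-
Copyright (c) 2026 the pub-hodgecm-mathlib formalisation cell (harness21).  Prover seat hodgecm-mathlib-K2E3-p12 (g8), Track B ∕ K2-LIT, h413 = `stmt-HodgeConjecture-24833`,
line `K2_E1_TraceFormulaBeta`, 5Res ROADCARD (154)∕(277), (KA)-road (B) step (B1) for K2E4-p10's FILE 2: the HERMITIAN LINE IDENTITY of the self-dual section pairing —
from ★ VectorGram in both orders, `⟨θ_g,θ_f⟩ = conj⟨θ_f,θ_g⟩`, cancellation of the Gram terms by ★ A Parseval I, and `t ↦ −t`.
-/
import Summits.HodgeConjecture.HodgeConjecture.Theorems.K2E1ChiPseudoEisensteinSelfDualVectorGramCMTwo   -- ★ p860772 (this seat): (SD) in vector-Gram currency + §1 Fubini integrability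
import HarnessLib

/-!
# (277)(B1) — `K2E1ChiPseudoEisensteinHermitianLineIdentityCMTwo`: `∫_ℝ f̃(−z)·conj g̃(−z̄)·( B_z(φ_a,φ_b) − conj B_w(φ_b,φ_a)|_{w = z̄} ) dt = 0` ON `Re z = σ₀ > 1`
# (`B_z(φ,φ′) = (ν𝓕)⁻¹∫_{K_U} φ·conj I_{φ′}(z̄,·) dμ_K`, so `B_{z̄}(φ_b,φ_a) = (ν𝓕)⁻¹∫_{K_U} φ_b·conj I_{φ_a}(z,·) dμ_K`; all `f, g ∈ C²_c((0,∞))`)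

Track B ∕ K2-LIT, crux h413 = `stmt-HodgeConjecture-24833`, route of record `HCCMUnconditional`; cell `hodgecm-mathlib`, squad K2, ENGINE E1.  THEOREMS ONLY (no `def`, no `instance`,
no `notation`, no named-fact hypothesis, no `sorry`); lane `--supports stmt-HodgeConjecture-24833 --as helper` (count-neutral).
THE MATHEMATICS ([MoeglinWaldspurger1995, II.2.1, IV.1.10]; [Langlands1976, §7]; dealer (277), K2E4-p10's (KA)-road (B)).  ★ VectorGram: `⟨θ_{f,a},θ_{g,b}⟩ = C(2π)⁻¹∫ f̃(−z)(⟪a,b⟫conj g̃(−(1−z̄)) +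
B_z(a,b)conj g̃(−z̄))dt` (`z = σ₀+it`).  Writing the same for `⟨θ_{g,b},θ_{f,a}⟩ = conj⟨θ_{f,a},θ_{g,b}⟩` (`integral_conj`) and splitting the `t`-integrals (§1 integrability: ★ A's `‖g̃‖ ≤ ∫r^{Re−1}|g|`
and ★ VectorGram §1 Fubini), the GRAM terms agree as integrals (§2: both are `(2π)⁻¹·2π∫_0^∞ g·conj f·r⁻²dr·⟪b,a⟫` by ★ A PARSEVAL I at `σ₀` for `(f,g)` and `(g,f)`, `conj` of a real-line integral),
leaving `∫ g̃(−z)B_z(b,a)conj f̃(−z̄) dt = conj ∫ f̃(−z)B_z(a,b)conj g̃(−z̄) dt`; the substitution `t ↦ −t` (`z ↦ z̄`, `integral_neg_eq_self`) turns the right side into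
`∫ g̃(−z)·conj f̃(−z̄)·conj B_{z̄}(a,b) dt`, whence **`∫ g̃(−z)·conj f̃(−z̄)·(B_z(b,a) − conj B_{z̄}(a,b)) dt = 0`** (§3) — the input of K2E4-p10's Mellin test-function density (B2) towards the
adjoint relation (KA) `B_z(b,a) = conj B_{z̄}(a,b)` (`M(z)* = M(z̄)`).
* §1 `integrable_mellin_mul_conj_mellin_oneSub`, `integral_mellin_mul_conj_mellin_oneSub_swap`, `integrable_mellin_mul_sectionPairing_cm_two`.  * §2 **`hermitian_line_identity_cm_two`**.
HONEST LABEL: HC_CM is proved only modulo the 7 printed citations (2 remaining named inputs: hLiu418 = `stmt-HodgeConjecture-24832`, h413 = `stmt-HodgeConjecture-24833`) until rung 0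
closes; this file asserts no named fact, closes no socket; count-neutral; letter-free.

## References
* [MoeglinWaldspurger1995] C. Mœglin, J.-L. Waldspurger, *Spectral decomposition and Eisenstein series* (1995), II.2.1, IV.1.10.
* [Langlands1976] R. P. Langlands, *On the Functional Equations Satisfied by Eisenstein Series*, LNM 544 (1976), §7.
* [Titchmarsh1948] E. C. Titchmarsh, *Introduction to the Theory of Fourier Integrals* (1948), Thm 71–72.
-/

set_option autoImplicit false
set_option linter.dupNamespace false  -- the mandated namespace repeats the summit's segment (`HodgeConjecture.HodgeConjecture`)

noncomputable section

open MeasureTheory Measure Set Filter Topology Complex NumberField IsDedekindDomain MulAction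
open scoped Real NNReal ENNReal ComplexConjugate Pointwise
open Literature.MeasureTheory.Group Literature.NumberTheory
open Literature.NumberTheory.Automorphic Literature.NumberTheory.Automorphic.UnitaryGroup AdelicGroupData
open Literature.NumberTheory.GaloisRepresentations (HeckeCharacter ideleGroup)
open Summit.HodgeConjecture.HodgeConjecture.Cruxes.H413.K2E1BorelEisensteinU
open Summit.HodgeConjecture.HodgeConjecture.Cruxes.H413.K2E1CharacterEisensteinU2Defs
open Summit.HodgeConjecture.HodgeConjecture.Cruxes.H413.K2E1MellinPaleyWienerHalfLine (differentiable_mellin norm_mellin_le setIntegral_mul_conj_mul_cpow_eq)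
open Summit.HodgeConjecture.HodgeConjecture.Cruxes.H413.K2E1PseudoEisensteinInnerProductCMTwoFinal (continuous_and_integrable_norm_mellin_neg)
open Summit.HodgeConjecture.HodgeConjecture.Cruxes.H413.K2E1ChiPseudoEisensteinSelfDualVectorGramCMTwo (chiPseudoEisenstein_inner_product_selfDual_vectorGram_cm_two integrable_selfDual_w0_prod_cm_two)

namespace Summit.HodgeConjecture.HodgeConjecture.Cruxes.H413.K2E1ChiPseudoEisensteinHermitianLineIdentityCMTwo

/-! ## §1 Integrability of the `t`-integrands; Parseval I swapped -/

section Analysis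

/-- `t ↦ f̃(−z_t)·conj g̃(−(1−z̄_t))` is integrable (`z_t = σ₀+it`; `‖f̃(−z_t)‖ ∈ L¹(dt)` for `f ∈ C²_c` ★ A, `‖g̃(−(1−z̄_t))‖ ≤ ∫ r^{σ₀−2}|g|` ★ A). [cite: Titchmarsh1948, Thm 71] -/
theorem integrable_mellin_mul_conj_mellin_oneSub {f g : ℝ → ℂ} (hf : ContDiff ℝ 2 f) (hfs : HasCompactSupport f) (hf0 : tsupport f ⊆ Ioi 0)
    (hg : ContDiff ℝ 2 g) (hgs : HasCompactSupport g) (hg0 : tsupport g ⊆ Ioi 0) (σ₀ : ℝ) :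
    Integrable fun t : ℝ => mellin f (-((σ₀ : ℂ) + t * I)) * conj (mellin g (-(1 - conj ((σ₀ : ℂ) + t * I)))) := by
  obtain ⟨-, hGi⟩ := continuous_and_integrable_norm_mellin_neg hf hfs hf0 σ₀
  have hmf : Continuous fun t : ℝ => mellin f (-((σ₀ : ℂ) + t * I)) := (differentiable_mellin hf.continuous hfs hf0).continuous.comp (by fun_prop : Continuous fun t : ℝ => -((σ₀ : ℂ) + t * I))
  have hm1 : Continuous fun t : ℝ => mellin g (-(1 - conj ((σ₀ : ℂ) + t * I))) := by
    simp_rw [neg_sub]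
    exact (differentiable_mellin hg.continuous hgs hg0).continuous.comp ((continuous_conj.comp (by fun_prop)).sub continuous_const)
  refine Integrable.mono' (hGi.mul_const (∫ r in Ioi 0, r ^ (σ₀ - 1 - 1) * ‖g r‖)) (hmf.mul (continuous_conj.comp hm1)).aestronglyMeasurable (ae_of_all _ fun t => ?_)
  rw [norm_mul, Complex.norm_conj]
  refine mul_le_mul_of_nonneg_left ?_ (norm_nonneg _)
  have h := norm_mellin_le g (-(1 - conj ((σ₀ : ℂ) + t * I)))
  have hre : (-(1 - conj ((σ₀ : ℂ) + t * I))).re = σ₀ - 1 := by simp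
  rwa [hre] at h

/-- **Parseval I swapped**: `∫ g̃(−z)·conj f̃(−(1−z̄)) dt = conj ∫ f̃(−z)·conj g̃(−(1−z̄)) dt` — both are `(2π)⁻¹`-multiples of `∫_0^∞ g·conj f·r⁻² dr` resp. its conjugate (★ A Parseval I at `σ₀` for
`(g,f)` and `(f,g)`; `conj (r⁻²) = r⁻²`). [cite: Titchmarsh1948, Thm 71–72] -/
theorem integral_mellin_mul_conj_mellin_oneSub_swap {f g : ℝ → ℂ} (hf : ContDiff ℝ 2 f) (hfs : HasCompactSupport f) (hf0 : tsupport f ⊆ Ioi 0)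
    (hg : ContDiff ℝ 2 g) (hgs : HasCompactSupport g) (hg0 : tsupport g ⊆ Ioi 0) (σ₀ : ℝ) :
    ∫ t : ℝ, mellin g (-((σ₀ : ℂ) + t * I)) * conj (mellin f (-(1 - conj ((σ₀ : ℂ) + t * I)))) = conj (∫ t : ℝ, mellin f (-((σ₀ : ℂ) + t * I)) * conj (mellin g (-(1 - conj ((σ₀ : ℂ) + t * I))))) := by
  have hc : ((((2 * π)⁻¹ : ℝ) : ℂ)) ≠ 0 := by
    rw [Complex.ofReal_ne_zero]; positivity
  have hP1 := setIntegral_mul_conj_mul_cpow_eq hg hgs hg0 hf.continuous hfs hf0 σ₀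
  have hP2 := setIntegral_mul_conj_mul_cpow_eq hf hfs hf0 hg.continuous hgs hg0 σ₀
  simp_rw [neg_sub]
  have hQ : conj (∫ r in Ioi (0 : ℝ), f r * conj (g r) * ((r : ℝ) : ℂ) ^ (-2 : ℂ)) = ∫ r in Ioi (0 : ℝ), g r * conj (f r) * ((r : ℝ) : ℂ) ^ (-2 : ℂ) := by
    rw [← integral_conj]
    refine setIntegral_congr_fun measurableSet_Ioi fun r hr => ?_
    have h2 : ((r : ℝ) : ℂ) ^ (-2 : ℂ) = (((r ^ (-2 : ℝ) : ℝ)) : ℂ) := by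
      rw [Complex.ofReal_cpow (le_of_lt hr)]; norm_num
    simp only [map_mul, Complex.conj_conj, h2, Complex.conj_ofReal]
    ring
  apply mul_left_cancel₀ hc
  rw [← hP1, ← hQ, hP2, map_mul, Complex.conj_ofReal]

end Analysis

variable (L : Type) [Field L] [NumberField L] [IsCMField L]
variable [MeasurableSpace (quasiSplit (↥(maximalRealSubfield L)) L (IsCMField.complexConj L) 2).Adelic] [BorelSpace (quasiSplit (↥(maximalRealSubfield L)) L (IsCMField.complexConj L) 2).Adelic]

/-- `t ↦ f̃(−z_t)·(B_{z_t}(φ,ψ)·conj g̃(−z̄_t))` is integrable (`B_z(φ,ψ) = (ν𝓕)⁻¹∫_{K_U} φ·conj I_ψ(z̄,·)`; from ★ VectorGram §1's `K_U × ℝ` integrability by `integral_prod_right`).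
[cite: MoeglinWaldspurger1995, II.2.1] -/
theorem integrable_mellin_mul_sectionPairing_cm_two (ν : Measure ↥(adelicUnipotent (↥(maximalRealSubfield L)) L (IsCMField.complexConj L) 2)) [ν.IsHaarMeasure] {𝓕 : Set ↥(adelicUnipotent (↥(maximalRealSubfield L)) L (IsCMField.complexConj L) 2)}
    (h𝓕N : IsFundamentalDomain ↥(rationalUnipotent (↥(maximalRealSubfield L)) L (IsCMField.complexConj L) 2) 𝓕 ν) (h𝓕c : IsCompact (closure 𝓕)) (μK : Measure ((standardMaximalCompactGL 2 L).comap (adelicVal (↥(maximalRealSubfield L)) L (IsCMField.complexConj L) 2 ((StdForm.antidiagonal 2).over L)) : Subgroup (quasiSplit (↥(maximalRealSubfield L)) L (IsCMField.complexConj L) 2).Adelic)) [IsFiniteMeasure μK]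
    {φ ψ : (quasiSplit (↥(maximalRealSubfield L)) L (IsCMField.complexConj L) 2).Adelic → ℂ} (hφc : Continuous φ) {Cφ : ℝ} (hφC : ∀ x, ‖φ x‖ ≤ Cφ) (hψc : Continuous ψ) {Cψ : ℝ} (hψC : ∀ x, ‖ψ x‖ ≤ Cψ)
    {f g : ℝ → ℂ} (hf : ContDiff ℝ 2 f) (hfs : HasCompactSupport f) (hf0 : tsupport f ⊆ Ioi 0) (hg : ContDiff ℝ 2 g) (hgs : HasCompactSupport g) (hg0 : tsupport g ⊆ Ioi 0)
    {σ₀ : ℝ} (hσ₀ : 1 < σ₀) :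
    Integrable fun t : ℝ => mellin f (-((σ₀ : ℂ) + t * I)) * ((((((ν 𝓕).toReal⁻¹ : ℝ)) : ℂ) * ∫ k : ((standardMaximalCompactGL 2 L).comap (adelicVal (↥(maximalRealSubfield L)) L (IsCMField.complexConj L) 2 ((StdForm.antidiagonal 2).over L)) : Subgroup (quasiSplit (↥(maximalRealSubfield L)) L (IsCMField.complexConj L) 2).Adelic), φ (k : (quasiSplit (↥(maximalRealSubfield L)) L (IsCMField.complexConj L) 2).Adelic) * conj (∫ v : ↥(adelicUnipotent (↥(maximalRealSubfield L)) L (IsCMField.complexConj L) 2), flatSectionU ψ (conj ((σ₀ : ℂ) + t * I)) (((quasiSplit (↥(maximalRealSubfield L)) L (IsCMField.complexConj L) 2).toAdelic (weylLongU ((IsCMField.complexConj L : L ≃ₐ[↥(maximalRealSubfield L)] L) : L →+* L) (rfl : (StdForm.antidiagonal 2).over L = (StdForm.antidiagonal 2).over L))) * ((v : (quasiSplit (↥(maximalRealSubfield L)) L (IsCMField.complexConj L) 2).Adelic) * (k : (quasiSplit (↥(maximalRealSubfield L)) L (IsCMField.complexConj L) 2).Adelic))) ∂ν) ∂μK) *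 conj (mellin g (-conj ((σ₀ : ℂ) + t * I)))) := by
  have h := ((integrable_selfDual_w0_prod_cm_two L ν h𝓕N h𝓕c μK hφc hφC hψc hψC hf hfs hf0 hg hgs hg0 hσ₀).integral_prod_right).const_mul (((((ν 𝓕).toReal⁻¹ : ℝ)) : ℂ))
  refine h.congr (ae_of_all _ fun t => ?_)
  dsimp only
  rw [show (∫ x : ((standardMaximalCompactGL 2 L).comap (adelicVal (↥(maximalRealSubfield L)) L (IsCMField.complexConj L) 2 ((StdForm.antidiagonal 2).over L)) : Subgroup (quasiSplit (↥(maximalRealSubfield L)) L (IsCMField.complexConj L) 2).Adelic), Function.uncurry (fun (k : ((standardMaximalCompactGL 2 L).comap (adelicVal (↥(maximalRealSubfield L)) L (IsCMField.complexConj L) 2 ((StdForm.antidiagonal 2).over L)) : Subgroup (quasiSplit (↥(maximalRealSubfield L)) L (IsCMField.complexConj L) 2).Adelic)) (t : ℝ) => φ (k : (quasiSplit (↥(maximalRealSubfield L)) L (IsCMField.complexConj L) 2).Adelic) * (mellin f (-((σ₀ : ℂ) + t * I)) * conj (mellin g (-conj ((σ₀ : ℂ) + t * I))) * conj (∫ v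 : ↥(adelicUnipotent (↥(maximalRealSubfield L)) L (IsCMField.complexConj L) 2), flatSectionU ψ (conj ((σ₀ : ℂ) + t * I)) (((quasiSplit (↥(maximalRealSubfield L)) L (IsCMField.complexConj L) 2).toAdelic (weylLongU ((IsCMField.complexConj L : L ≃ₐ[↥(maximalRealSubfield L)] L) : L →+* L) (rfl : (StdForm.antidiagonal 2).over L = (StdForm.antidiagonal 2).over L))) * ((v : (quasiSplit (↥(maximalRealSubfield L)) L (IsCMField.complexConj L) 2).Adelic) * (k : (quasiSplit (↥(maximalRealSubfield L)) L (IsCMField.complexConj L) 2).Adelic))) ∂ν))) (x, t) ∂μK) =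
      ∫ k : ((standardMaximalCompactGL 2 L).comap (adelicVal (↥(maximalRealSubfield L)) L (IsCMField.complexConj L) 2 ((StdForm.antidiagonal 2).over L)) : Subgroup (quasiSplit (↥(maximalRealSubfield L)) L (IsCMField.complexConj L) 2).Adelic), φ (k : (quasiSplit (↥(maximalRealSubfield L)) L (IsCMField.complexConj L) 2).Adelic) * (mellin f (-((σ₀ : ℂ) + t * I)) * conj (mellin g (-conj ((σ₀ : ℂ) + t * I))) * conj (∫ v : ↥(adelicUnipotent (↥(maximalRealSubfield L)) L (IsCMField.complexConj L) 2), flatSectionU ψ (conj ((σ₀ : ℂ) + t * I)) (((quasiSplit (↥(maximalRealSubfield L)) L (IsCMField.complexConj L) 2).toAdelic (weylLongU ((IsCMField.complexConj L : L ≃ₐ[↥(maximalRealSubfield L)] L) : L →+* L) (rfl : (StdForm.antidiagonal 2).over L = (StdForm.antidiagonal 2).over L))) * ((v : (quasiSplit (↥(maximalRealSubfield L)) L (IsCMField.complexConj L) 2).Adelic) * (k : (quasiSplit (↥(maximalRealSubfield L)) L (IsCMField.complexConj L) 2).Adelic))) ∂ν)) ∂μK from rfl]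
  have e : ∫ k : ((standardMaximalCompactGL 2 L).comap (adelicVal (↥(maximalRealSubfield L)) L (IsCMField.complexConj L) 2 ((StdForm.antidiagonal 2).over L)) : Subgroup (quasiSplit (↥(maximalRealSubfield L)) L (IsCMField.complexConj L) 2).Adelic), φ (k : (quasiSplit (↥(maximalRealSubfield L)) L (IsCMField.complexConj L) 2).Adelic) * (mellin f (-((σ₀ : ℂ) + t * I)) * conj (mellin g (-conj ((σ₀ : ℂ) + t * I))) * conj (∫ v : ↥(adelicUnipotent (↥(maximalRealSubfield L)) L (IsCMField.complexConj L) 2), flatSectionU ψ (conj ((σ₀ : ℂ) + t * I)) (((quasiSplit (↥(maximalRealSubfield L)) L (IsCMField.complexConj L) 2).toAdelic (weylLongU ((IsCMField.complexConj L : L ≃ₐ[↥(maximalRealSubfield L)] L) : L →+* L) (rfl : (StdForm.antidiagonal 2).over L = (StdForm.antidiagonal 2).over L))) * ((v : (quasiSplit (↥(maximalRealSubfield L)) L (IsCMField.complexConj L) 2).Adelic) * (k : (quasiSplit (↥(maximalRealSubfield L)) L (IsCMField.complexConj L) 2).Adelic))) ∂ν)) ∂μK =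
      (mellin f (-((σ₀ : ℂ) + t * I)) * conj (mellin g (-conj ((σ₀ : ℂ) + t * I)))) * ∫ k : ((standardMaximalCompactGL 2 L).comap (adelicVal (↥(maximalRealSubfield L)) L (IsCMField.complexConj L) 2 ((StdForm.antidiagonal 2).over L)) : Subgroup (quasiSplit (↥(maximalRealSubfield L)) L (IsCMField.complexConj L) 2).Adelic), φ (k : (quasiSplit (↥(maximalRealSubfield L)) L (IsCMField.complexConj L) 2).Adelic) * conj (∫ v : ↥(adelicUnipotent (↥(maximalRealSubfield L)) L (IsCMField.complexConj L) 2), flatSectionU ψ (conj ((σ₀ : ℂ) + t * I)) (((quasiSplit (↥(maximalRealSubfield L)) L (IsCMField.complexConj L) 2).toAdelic (weylLongU ((IsCMField.complexConj L : L ≃ₐ[↥(maximalRealSubfield L)] L) : L →+* L) (rfl : (StdForm.antidiagonal 2).over L = (StdForm.antidiagonal 2).over L))) * ((v : (quasiSplit (↥(maximalRealSubfield L)) L (IsCMField.complexConj L) 2).Adelic) * (k : (quasiSplit (↥(maximalRealSubfield L)) L (IsCMField.complexConj L) 2).Adelic))) ∂ν) ∂μK := by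
    rw [← integral_const_mul]
    exact integral_congr_ae (ae_of_all _ fun k => by ring)
  rw [e]
  ring

variable [MeasurableSpace (AdeleRing (𝓞 L) L)ˣ] [BorelSpace (AdeleRing (𝓞 L) L)ˣ]

/-! ## §2 The Hermitian line identity -/

/-- **(B1) THE HERMITIAN LINE IDENTITY.**  Data as in ★ W-b.  For a UNITARY SELF-DUAL `χ` (`χʷ = χ`), continuous bounded `χ`-sections `φ_a, φ_b`, `f, g ∈ C²_c((0,∞))` and `σ₀ > 1`
(`z = σ₀ + it`): **`∫_ℝ f̃(−z)·conj g̃(−z̄)·B_z(φ_a,φ_b) dt = ∫_ℝ f̃(−z)·conj g̃(−z̄)·conj B_{z̄}(φ_b,φ_a) dt`** (equality-of-integrals form of the vanishing of `∫ f̃ conj g̃ (B − conj B′)`), with `B_z(φ,φ′) = (ν𝓕)⁻¹·∫_{K_U} φ(k)·conj I_{φ′}(z̄,k) dμ_K` and hence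
`B_{z̄}(φ_b,φ_a) = (ν𝓕)⁻¹·∫_{K_U} φ_b(k)·conj I_{φ_a}(z,k) dμ_K` (`I_{φ′}(w,k) = ∫_{N(𝔸)}(φ′H^w)(w₀vk)dν`).  Proof: ★ VectorGram for `(f,a;g,b)` and `(g,b;f,a)`,
`⟨θ_{g,b},θ_{f,a}⟩ = conj⟨θ_{f,a},θ_{g,b}⟩`, §1 cancels the Gram terms, `t ↦ −t`. [cite: MoeglinWaldspurger1995, II.2.1, IV.1.10] [cite: Langlands1976, §7] -/
theorem hermitian_line_identity_cm_two
    (μ : Measure (quasiSplit (↥(maximalRealSubfield L)) L (IsCMField.complexConj L) 2).automorphicQuotient) [(quasiSplit (↥(maximalRealSubfield L)) L (IsCMField.complexConj L) 2).IsAutomorphicMeasure μ]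
    (νG : Measure (quasiSplit (↥(maximalRealSubfield L)) L (IsCMField.complexConj L) 2).Adelic) [νG.IsHaarMeasure] [νG.IsInvInvariant]
    (μK : Measure ((standardMaximalCompactGL 2 L).comap (adelicVal (↥(maximalRealSubfield L)) L (IsCMField.complexConj L) 2 ((StdForm.antidiagonal 2).over L)) : Subgroup (quasiSplit (↥(maximalRealSubfield L)) L (IsCMField.complexConj L) 2).Adelic)) [μK.IsHaarMeasure]
    (νI : Measure (AdeleRing (𝓞 L) L)ˣ) [νI.IsHaarMeasure]
    {𝓕I : Set (AdeleRing (𝓞 L) L)ˣ} (h𝓕I : IsIdeleClassDomain L 𝓕I)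
    (ν : Measure ↥(adelicUnipotent (↥(maximalRealSubfield L)) L (IsCMField.complexConj L) 2)) [ν.IsHaarMeasure] {𝓕 : Set ↥(adelicUnipotent (↥(maximalRealSubfield L)) L (IsCMField.complexConj L) 2)}
    (h𝓕N : IsFundamentalDomain ↥(rationalUnipotent (↥(maximalRealSubfield L)) L (IsCMField.complexConj L) 2) 𝓕 ν) (h𝓕c : IsCompact (closure 𝓕)) (h𝓕₀ : ν 𝓕 ≠ 0)
    {χ : HeckeCharacter L} (hχu : χ.IsUnitary) (hsd : reflectChar (IsCMField.complexConj L) χ = χ)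
    {φa φb : (quasiSplit (↥(maximalRealSubfield L)) L (IsCMField.complexConj L) 2).Adelic → ℂ} (hφa : IsChiSection χ φa) (hφac : Continuous φa) {Ca : ℝ} (hφaC : ∀ x, ‖φa x‖ ≤ Ca)
    (hφb : IsChiSection χ φb) (hφbc : Continuous φb) {Cb : ℝ} (hφbC : ∀ x, ‖φb x‖ ≤ Cb)
    {f g : ℝ → ℂ} (hf : ContDiff ℝ 2 f) (hfs : HasCompactSupport f) (hf0 : tsupport f ⊆ Ioi 0) (hg : ContDiff ℝ 2 g) (hgs : HasCompactSupport g) (hg0 : tsupport g ⊆ Ioi 0)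
    {σ₀ : ℝ} (hσ₀ : 1 < σ₀) :
    ∫ t : ℝ, mellin f (-((σ₀ : ℂ) + t * I)) * conj (mellin g (-conj ((σ₀ : ℂ) + t * I))) * (((((ν 𝓕).toReal⁻¹ : ℝ)) : ℂ) * ∫ k : ((standardMaximalCompactGL 2 L).comap (adelicVal (↥(maximalRealSubfield L)) L (IsCMField.complexConj L) 2 ((StdForm.antidiagonal 2).over L)) : Subgroup (quasiSplit (↥(maximalRealSubfield L)) L (IsCMField.complexConj L) 2).Adelic), φa (k : (quasiSplit (↥(maximalRealSubfield L)) L (IsCMField.complexConj L) 2).Adelic) * conj (∫ v : ↥(adelicUnipotent (↥(maximalRealSubfield L)) L (IsCMField.complexConj L) 2), flatSectionU φb (conj ((σ₀ : ℂ) + t * I)) (((quasiSplit (↥(maximalRealSubfield L)) L (IsCMField.complexConj L) 2).toAdelic (weylLongU ((IsCMField.complexConj L : L ≃ₐ[↥(maximalRealSubfield L)] L) : L →+* L) (rfl : (StdForm.antidiagonal 2).over L = (StdForm.antidiagonal 2).over L))) * ((v : (quasiSplit (↥(maximalRealSubfield L)) L (IsCMField.complexConj L) 2).Adelic) * (k :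 (quasiSplit (↥(maximalRealSubfield L)) L (IsCMField.complexConj L) 2).Adelic))) ∂ν) ∂μK) = ∫ t : ℝ, mellin f (-((σ₀ : ℂ) + t * I)) * conj (mellin g (-conj ((σ₀ : ℂ) + t * I))) * conj ((((((ν 𝓕).toReal⁻¹ : ℝ)) : ℂ) * ∫ k : ((standardMaximalCompactGL 2 L).comap (adelicVal (↥(maximalRealSubfield L)) L (IsCMField.complexConj L) 2 ((StdForm.antidiagonal 2).over L)) : Subgroup (quasiSplit (↥(maximalRealSubfield L)) L (IsCMField.complexConj L) 2).Adelic), φb (k : (quasiSplit (↥(maximalRealSubfield L)) L (IsCMField.complexConj L) 2).Adelic) * conj (∫ v : ↥(adelicUnipotent (↥(maximalRealSubfield L)) L (IsCMField.complexConj L) 2), flatSectionU φa ((σ₀ : ℂ) + t * I) (((quasiSplit (↥(maximalRealSubfield L)) L (IsCMField.complexConj L) 2).toAdelic (weylLongU ((IsCMField.complexConj L : L ≃ₐ[↥(maximalRealSubfield L)] L) : L →+* L) (rfl : (StdForm.antidiagonal 2).over L = (StdForm.antidiagonal 2).over L))) * ((v : (quasiSplit (↥(maximalRealSubfield L)) L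 (IsCMField.complexConj L) 2).Adelic) * (k : (quasiSplit (↥(maximalRealSubfield L)) L (IsCMField.complexConj L) 2).Adelic))) ∂ν) ∂μK)) := by
  haveI := t2Space_adeleRing_of_numberField L
  haveI := locallyCompactSpace_adeleRing' L
  have hKc : IsCompact ((((standardMaximalCompactGL 2 L).comap (adelicVal (↥(maximalRealSubfield L)) L (IsCMField.complexConj L) 2 ((StdForm.antidiagonal 2).over L)) : Subgroup (quasiSplit (↥(maximalRealSubfield L)) L (IsCMField.complexConj L) 2).Adelic)) : Set (quasiSplit (↥(maximalRealSubfield L)) L (IsCMField.complexConj L) 2).Adelic) := isCompact_comap_adelicVal_standardMaximalCompactGL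
  haveI : CompactSpace ((standardMaximalCompactGL 2 L).comap (adelicVal (↥(maximalRealSubfield L)) L (IsCMField.complexConj L) 2 ((StdForm.antidiagonal 2).over L)) : Subgroup (quasiSplit (↥(maximalRealSubfield L)) L (IsCMField.complexConj L) 2).Adelic) := isCompact_iff_compactSpace.1 hKc
  haveI : IsFiniteMeasure μK := CompactSpace.isFiniteMeasure
  have hVG := chiPseudoEisenstein_inner_product_selfDual_vectorGram_cm_two L μ νG μK νI h𝓕I ν h𝓕N h𝓕c h𝓕₀
  have hC : 0 < Classical.choose hVG := (Classical.choose_spec hVG).1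
  have hc2 : ((((2 * π)⁻¹ : ℝ) : ℂ)) ≠ 0 := by rw [Complex.ofReal_ne_zero]; positivity
  have hC0 : ((Classical.choose hVG : ℝ) : ℂ) ≠ 0 := by rw [Complex.ofReal_ne_zero]; exact hC.ne'
  -- the two vector-Gram formulas
  have h1 := ((Classical.choose_spec hVG).2 hχu hsd hφa hφac hφaC hφb hφbc hφbC hf hfs hf0 hg hgs hg0 hσ₀).2
  have h2 := ((Classical.choose_spec hVG).2 hχu hsd hφb hφbc hφbC hφa hφac hφaC hg hgs hg0 hf hfs hf0 hσ₀).2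
  -- `⟨θ_{g,b}, θ_{f,a}⟩ = conj ⟨θ_{f,a}, θ_{g,b}⟩`
  have hswap : ∫ x, (quasiSplit (↥(maximalRealSubfield L)) L (IsCMField.complexConj L) 2).quotFun (eisensteinSeriesU (fun x₀ : (quasiSplit (↥(maximalRealSubfield L)) L (IsCMField.complexConj L) 2).Adelic => g (borelHeight x₀ : ℝ) * φb x₀)) x * conj ((quasiSplit (↥(maximalRealSubfield L)) L (IsCMField.complexConj L) 2).quotFun (eisensteinSeriesU (fun x₀ : (quasiSplit (↥(maximalRealSubfield L)) L (IsCMField.complexConj L) 2).Adelic => f (borelHeight x₀ : ℝ) * φa x₀)) x) ∂μ = conj (∫ x, (quasiSplit (↥(maximalRealSubfield L)) L (IsCMField.complexConj L) 2).quotFun (eisensteinSeriesU (fun x₀ : (quasiSplit (↥(maximalRealSubfield L)) L (IsCMField.complexConj L) 2).Adelic => f (borelHeight x₀ : ℝ) * φa x₀)) x * conj ((quasiSplit (↥(maximalRealSubfield L)) L (IsCMField.complexConj L) 2).quotFun (eisensteinSeriesU (fun x₀ : (quasiSplit (↥(maximalRealSubfield L)) L (IsCMField.complexConj L) 2).Adelic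 => g (borelHeight x₀ : ℝ) * φb x₀)) x) ∂μ) := by
    rw [← integral_conj]
    exact integral_congr_ae (ae_of_all _ fun x => by simp only [map_mul, Complex.conj_conj]; ring)
  -- integrability of the four `t`-integrands
  have hI1a := (integrable_mellin_mul_conj_mellin_oneSub hf hfs hf0 hg hgs hg0 σ₀).mul_const (∫ k : ((standardMaximalCompactGL 2 L).comap (adelicVal (↥(maximalRealSubfield L)) L (IsCMField.complexConj L) 2 ((StdForm.antidiagonal 2).over L)) : Subgroup (quasiSplit (↥(maximalRealSubfield L)) L (IsCMField.complexConj L) 2).Adelic), φa (k : (quasiSplit (↥(maximalRealSubfield L)) L (IsCMField.complexConj L) 2).Adelic) * conj (φb (k : (quasiSplit (↥(maximalRealSubfield L)) L (IsCMField.complexConj L) 2).Adelic)) ∂μK)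
  have hI1b := (integrable_mellin_mul_conj_mellin_oneSub hg hgs hg0 hf hfs hf0 σ₀).mul_const (∫ k : ((standardMaximalCompactGL 2 L).comap (adelicVal (↥(maximalRealSubfield L)) L (IsCMField.complexConj L) 2 ((StdForm.antidiagonal 2).over L)) : Subgroup (quasiSplit (↥(maximalRealSubfield L)) L (IsCMField.complexConj L) 2).Adelic), φb (k : (quasiSplit (↥(maximalRealSubfield L)) L (IsCMField.complexConj L) 2).Adelic) * conj (φa (k : (quasiSplit (↥(maximalRealSubfield L)) L (IsCMField.complexConj L) 2).Adelic)) ∂μK)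
  have hI2a := integrable_mellin_mul_sectionPairing_cm_two L ν h𝓕N h𝓕c μK hφac hφaC hφbc hφbC hf hfs hf0 hg hgs hg0 hσ₀
  have hI2b := integrable_mellin_mul_sectionPairing_cm_two L ν h𝓕N h𝓕c μK hφbc hφbC hφac hφaC hg hgs hg0 hf hfs hf0 hσ₀
  -- split the two `t`-integrals
  have hs1 : ∫ t : ℝ, mellin f (-((σ₀ : ℂ) + t * I)) * ((∫ k : ((standardMaximalCompactGL 2 L).comap (adelicVal (↥(maximalRealSubfield L)) L (IsCMField.complexConj L) 2 ((StdForm.antidiagonal 2).over L)) : Subgroup (quasiSplit (↥(maximalRealSubfield L)) L (IsCMField.complexConj L) 2).Adelic), φa (k : (quasiSplit (↥(maximalRealSubfield L)) L (IsCMField.complexConj L) 2).Adelic) * conj (φb (k : (quasiSplit (↥(maximalRealSubfield L)) L (IsCMField.complexConj L) 2).Adelic)) ∂μK) * conj (mellin g (-(1 - conj ((σ₀ : ℂ) + t * I)))) + (((((ν 𝓕).toReal⁻¹ : ℝ)) : ℂ) * ∫ k : ((standardMaximalCompactGL 2 L).comap (adelicVal (↥(maximalRealSubfield L)) L (IsCMField.complexConj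 L) 2 ((StdForm.antidiagonal 2).over L)) : Subgroup (quasiSplit (↥(maximalRealSubfield L)) L (IsCMField.complexConj L) 2).Adelic), φa (k : (quasiSplit (↥(maximalRealSubfield L)) L (IsCMField.complexConj L) 2).Adelic) * conj (∫ v : ↥(adelicUnipotent (↥(maximalRealSubfield L)) L (IsCMField.complexConj L) 2), flatSectionU φb (conj ((σ₀ : ℂ) + t * I)) (((quasiSplit (↥(maximalRealSubfield L)) L (IsCMField.complexConj L) 2).toAdelic (weylLongU ((IsCMField.complexConj L : L ≃ₐ[↥(maximalRealSubfield L)] L) : L →+* L) (rfl : (StdForm.antidiagonal 2).over L = (StdForm.antidiagonal 2).over L))) * ((v : (quasiSplit (↥(maximalRealSubfield L)) L (IsCMField.complexConj L) 2).Adelic) * (k : (quasiSplit (↥(maximalRealSubfield L)) L (IsCMField.complexConj L) 2).Adelic))) ∂ν) ∂μK) * conj (mellin g (-conj ((σ₀ : ℂ) + t * I)))) =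
      (∫ t : ℝ, mellin f (-((σ₀ : ℂ) + t * I)) * conj (mellin g (-(1 - conj ((σ₀ : ℂ) + t * I)))) * (∫ k : ((standardMaximalCompactGL 2 L).comap (adelicVal (↥(maximalRealSubfield L)) L (IsCMField.complexConj L) 2 ((StdForm.antidiagonal 2).over L)) : Subgroup (quasiSplit (↥(maximalRealSubfield L)) L (IsCMField.complexConj L) 2).Adelic), φa (k : (quasiSplit (↥(maximalRealSubfield L)) L (IsCMField.complexConj L) 2).Adelic) * conj (φb (k : (quasiSplit (↥(maximalRealSubfield L)) L (IsCMField.complexConj L) 2).Adelic)) ∂μK)) + ∫ t : ℝ, mellin f (-((σ₀ : ℂ) + t * I)) * ((((((ν 𝓕).toReal⁻¹ : ℝ)) : ℂ) * ∫ k : ((standardMaximalCompactGL 2 L).comap (adelicVal (↥(maximalRealSubfield L)) L (IsCMField.complexConj L) 2 ((StdForm.antidiagonal 2).over L)) : Subgroup (quasiSplit (↥(maximalRealSubfield L)) L (IsCMField.complexConj L) 2).Adelic), φa (k : (quasiSplit (↥(maximalRealSubfield L)) L (IsCMField.complexConj L) 2).Adelic) * conj (∫ v : ↥(adelicUnipotent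 (↥(maximalRealSubfield L)) L (IsCMField.complexConj L) 2), flatSectionU φb (conj ((σ₀ : ℂ) + t * I)) (((quasiSplit (↥(maximalRealSubfield L)) L (IsCMField.complexConj L) 2).toAdelic (weylLongU ((IsCMField.complexConj L : L ≃ₐ[↥(maximalRealSubfield L)] L) : L →+* L) (rfl : (StdForm.antidiagonal 2).over L = (StdForm.antidiagonal 2).over L))) * ((v : (quasiSplit (↥(maximalRealSubfield L)) L (IsCMField.complexConj L) 2).Adelic) * (k : (quasiSplit (↥(maximalRealSubfield L)) L (IsCMField.complexConj L) 2).Adelic))) ∂ν) ∂μK) * conj (mellin g (-conj ((σ₀ : ℂ) + t * I)))) := by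
    rw [← integral_add hI1a hI2a]
    exact integral_congr_ae (ae_of_all _ fun t => by ring)
  have hs2 : ∫ t : ℝ, mellin g (-((σ₀ : ℂ) + t * I)) * ((∫ k : ((standardMaximalCompactGL 2 L).comap (adelicVal (↥(maximalRealSubfield L)) L (IsCMField.complexConj L) 2 ((StdForm.antidiagonal 2).over L)) : Subgroup (quasiSplit (↥(maximalRealSubfield L)) L (IsCMField.complexConj L) 2).Adelic), φb (k : (quasiSplit (↥(maximalRealSubfield L)) L (IsCMField.complexConj L) 2).Adelic) * conj (φa (k : (quasiSplit (↥(maximalRealSubfield L)) L (IsCMField.complexConj L) 2).Adelic)) ∂μK) * conj (mellin f (-(1 - conj ((σ₀ : ℂ) + t * I)))) + (((((ν 𝓕).toReal⁻¹ : ℝ)) : ℂ) * ∫ k : ((standardMaximalCompactGL 2 L).comap (adelicVal (↥(maximalRealSubfield L)) L (IsCMField.complexConj L) 2 ((StdForm.antidiagonal 2).over L)) : Subgroup (quasiSplit (↥(maximalRealSubfield L)) L (IsCMField.complexConj L) 2).Adelic), φb (k : (quasiSplit (↥(maximalRealSubfield L)) L (IsCMField.complexConj L) 2).Adelic) * conj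 (∫ v : ↥(adelicUnipotent (↥(maximalRealSubfield L)) L (IsCMField.complexConj L) 2), flatSectionU φa (conj ((σ₀ : ℂ) + t * I)) (((quasiSplit (↥(maximalRealSubfield L)) L (IsCMField.complexConj L) 2).toAdelic (weylLongU ((IsCMField.complexConj L : L ≃ₐ[↥(maximalRealSubfield L)] L) : L →+* L) (rfl : (StdForm.antidiagonal 2).over L = (StdForm.antidiagonal 2).over L))) * ((v : (quasiSplit (↥(maximalRealSubfield L)) L (IsCMField.complexConj L) 2).Adelic) * (k : (quasiSplit (↥(maximalRealSubfield L)) L (IsCMField.complexConj L) 2).Adelic))) ∂ν) ∂μK) * conj (mellin f (-conj ((σ₀ : ℂ) + t * I)))) =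
      (∫ t : ℝ, mellin g (-((σ₀ : ℂ) + t * I)) * conj (mellin f (-(1 - conj ((σ₀ : ℂ) + t * I)))) * (∫ k : ((standardMaximalCompactGL 2 L).comap (adelicVal (↥(maximalRealSubfield L)) L (IsCMField.complexConj L) 2 ((StdForm.antidiagonal 2).over L)) : Subgroup (quasiSplit (↥(maximalRealSubfield L)) L (IsCMField.complexConj L) 2).Adelic), φb (k : (quasiSplit (↥(maximalRealSubfield L)) L (IsCMField.complexConj L) 2).Adelic) * conj (φa (k : (quasiSplit (↥(maximalRealSubfield L)) L (IsCMField.complexConj L) 2).Adelic)) ∂μK)) + ∫ t : ℝ, mellin g (-((σ₀ : ℂ) + t * I)) * ((((((ν 𝓕).toReal⁻¹ : ℝ)) : ℂ) * ∫ k : ((standardMaximalCompactGL 2 L).comap (adelicVal (↥(maximalRealSubfield L)) L (IsCMField.complexConj L) 2 ((StdForm.antidiagonal 2).over L)) : Subgroup (quasiSplit (↥(maximalRealSubfield L)) L (IsCMField.complexConj L) 2).Adelic), φb (k : (quasiSplit (↥(maximalRealSubfield L)) L (IsCMField.complexConj L) 2).Adelic) * conj (∫ v : ↥(adelicUnipotent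 (↥(maximalRealSubfield L)) L (IsCMField.complexConj L) 2), flatSectionU φa (conj ((σ₀ : ℂ) + t * I)) (((quasiSplit (↥(maximalRealSubfield L)) L (IsCMField.complexConj L) 2).toAdelic (weylLongU ((IsCMField.complexConj L : L ≃ₐ[↥(maximalRealSubfield L)] L) : L →+* L) (rfl : (StdForm.antidiagonal 2).over L = (StdForm.antidiagonal 2).over L))) * ((v : (quasiSplit (↥(maximalRealSubfield L)) L (IsCMField.complexConj L) 2).Adelic) * (k : (quasiSplit (↥(maximalRealSubfield L)) L (IsCMField.complexConj L) 2).Adelic))) ∂ν) ∂μK) * conj (mellin f (-conj ((σ₀ : ℂ) + t * I)))) := by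
    rw [← integral_add hI1b hI2b]
    exact integral_congr_ae (ae_of_all _ fun t => by ring)
  -- the Gram terms agree
  have hAconj : (∫ k : ((standardMaximalCompactGL 2 L).comap (adelicVal (↥(maximalRealSubfield L)) L (IsCMField.complexConj L) 2 ((StdForm.antidiagonal 2).over L)) : Subgroup (quasiSplit (↥(maximalRealSubfield L)) L (IsCMField.complexConj L) 2).Adelic), φb (k : (quasiSplit (↥(maximalRealSubfield L)) L (IsCMField.complexConj L) 2).Adelic) * conj (φa (k : (quasiSplit (↥(maximalRealSubfield L)) L (IsCMField.complexConj L) 2).Adelic)) ∂μK) = conj (∫ k : ((standardMaximalCompactGL 2 L).comap (adelicVal (↥(maximalRealSubfield L)) L (IsCMField.complexConj L) 2 ((StdForm.antidiagonal 2).over L)) : Subgroup (quasiSplit (↥(maximalRealSubfield L)) L (IsCMField.complexConj L) 2).Adelic), φa (k : (quasiSplit (↥(maximalRealSubfield L)) L (IsCMField.complexConj L) 2).Adelic) * conj (φb (k : (quasiSplit (↥(maximalRealSubfield L)) L (IsCMField.complexConj L) 2).Adelic)) ∂μK) := by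
    rw [← integral_conj]
    exact integral_congr_ae (ae_of_all _ fun k => by simp only [map_mul, Complex.conj_conj]; ring)
  have hG : (∫ t : ℝ, mellin g (-((σ₀ : ℂ) + t * I)) * conj (mellin f (-(1 - conj ((σ₀ : ℂ) + t * I)))) * (∫ k : ((standardMaximalCompactGL 2 L).comap (adelicVal (↥(maximalRealSubfield L)) L (IsCMField.complexConj L) 2 ((StdForm.antidiagonal 2).over L)) : Subgroup (quasiSplit (↥(maximalRealSubfield L)) L (IsCMField.complexConj L) 2).Adelic), φb (k : (quasiSplit (↥(maximalRealSubfield L)) L (IsCMField.complexConj L) 2).Adelic) * conj (φa (k : (quasiSplit (↥(maximalRealSubfield L)) L (IsCMField.complexConj L) 2).Adelic)) ∂μK)) = conj (∫ t : ℝ, mellin f (-((σ₀ : ℂ) + t * I)) * conj (mellin g (-(1 - conj ((σ₀ : ℂ) + t * I)))) * (∫ k : ((standardMaximalCompactGL 2 L).comap (adelicVal (↥(maximalRealSubfield L)) L (IsCMField.complexConj L) 2 ((StdForm.antidiagonal 2).over L)) : Subgroup (quasiSplit (↥(maximalRealSubfield L)) L (IsCMField.complexConj L) 2).Adelic), φa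 (k : (quasiSplit (↥(maximalRealSubfield L)) L (IsCMField.complexConj L) 2).Adelic) * conj (φb (k : (quasiSplit (↥(maximalRealSubfield L)) L (IsCMField.complexConj L) 2).Adelic)) ∂μK)) := by
    rw [integral_mul_const, integral_mul_const, map_mul, integral_mellin_mul_conj_mellin_oneSub_swap hf hfs hf0 hg hgs hg0 σ₀, hAconj]
  -- hence the second terms: `∫ g̃ B(b,a) conj f̃(−z̄) = conj ∫ f̃ B(a,b) conj g̃(−z̄)`
  have hkey : ∫ t : ℝ, mellin g (-((σ₀ : ℂ) + t * I)) * ((((((ν 𝓕).toReal⁻¹ : ℝ)) : ℂ) * ∫ k : ((standardMaximalCompactGL 2 L).comap (adelicVal (↥(maximalRealSubfield L)) L (IsCMField.complexConj L) 2 ((StdForm.antidiagonal 2).over L)) : Subgroup (quasiSplit (↥(maximalRealSubfield L)) L (IsCMField.complexConj L) 2).Adelic), φb (k : (quasiSplit (↥(maximalRealSubfield L)) L (IsCMField.complexConj L) 2).Adelic) * conj (∫ v : ↥(adelicUnipotent (↥(maximalRealSubfield L)) L (IsCMField.complexConj L) 2), flatSectionU φa (conj ((σ₀ : ℂ) + t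 * I)) (((quasiSplit (↥(maximalRealSubfield L)) L (IsCMField.complexConj L) 2).toAdelic (weylLongU ((IsCMField.complexConj L : L ≃ₐ[↥(maximalRealSubfield L)] L) : L →+* L) (rfl : (StdForm.antidiagonal 2).over L = (StdForm.antidiagonal 2).over L))) * ((v : (quasiSplit (↥(maximalRealSubfield L)) L (IsCMField.complexConj L) 2).Adelic) * (k : (quasiSplit (↥(maximalRealSubfield L)) L (IsCMField.complexConj L) 2).Adelic))) ∂ν) ∂μK) * conj (mellin f (-conj ((σ₀ : ℂ) + t * I)))) = conj (∫ t : ℝ, mellin f (-((σ₀ : ℂ) + t * I)) * ((((((ν 𝓕).toReal⁻¹ : ℝ)) : ℂ) * ∫ k : ((standardMaximalCompactGL 2 L).comap (adelicVal (↥(maximalRealSubfield L)) L (IsCMField.complexConj L) 2 ((StdForm.antidiagonal 2).over L)) : Subgroup (quasiSplit (↥(maximalRealSubfield L)) L (IsCMField.complexConj L) 2).Adelic), φa (k : (quasiSplit (↥(maximalRealSubfield L)) L (IsCMField.complexConj L) 2).Adelic) * conj (∫ v : ↥(adelicUnipotent (↥(maximalRealSubfield L)) L (IsCMField.complexConj L)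 2), flatSectionU φb (conj ((σ₀ : ℂ) + t * I)) (((quasiSplit (↥(maximalRealSubfield L)) L (IsCMField.complexConj L) 2).toAdelic (weylLongU ((IsCMField.complexConj L : L ≃ₐ[↥(maximalRealSubfield L)] L) : L →+* L) (rfl : (StdForm.antidiagonal 2).over L = (StdForm.antidiagonal 2).over L))) * ((v : (quasiSplit (↥(maximalRealSubfield L)) L (IsCMField.complexConj L) 2).Adelic) * (k : (quasiSplit (↥(maximalRealSubfield L)) L (IsCMField.complexConj L) 2).Adelic))) ∂ν) ∂μK) * conj (mellin g (-conj ((σ₀ : ℂ) + t * I))))) := by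
    have h := h2
    rw [hswap, h1, hs1, hs2, map_mul, map_mul, Complex.conj_ofReal, Complex.conj_ofReal, map_add, ← hG] at h
    have h' := mul_left_cancel₀ hc2 (mul_left_cancel₀ hC0 h)
    exact (add_left_cancel h').symm
  -- `t ↦ −t` on the right-hand side
  have hneg : ∀ t : ℝ, (σ₀ : ℂ) + ((-t : ℝ) : ℂ) * I = conj ((σ₀ : ℂ) + t * I) := fun t => by
    apply Complex.ext <;> simp
  have hflip : conj (∫ t : ℝ, mellin g (-((σ₀ : ℂ) + t * I)) * ((((((ν 𝓕).toReal⁻¹ : ℝ)) : ℂ) * ∫ k : ((standardMaximalCompactGL 2 L).comap (adelicVal (↥(maximalRealSubfield L)) L (IsCMField.complexConj L) 2 ((StdForm.antidiagonal 2).over L)) : Subgroup (quasiSplit (↥(maximalRealSubfield L)) L (IsCMField.complexConj L) 2).Adelic), φb (k : (quasiSplit (↥(maximalRealSubfield L)) L (IsCMField.complexConj L) 2).Adelic) * conj (∫ v : ↥(adelicUnipotent (↥(maximalRealSubfield L)) L (IsCMField.complexConj L) 2), flatSectionU φa (conj ((σ₀ : ℂ) + t * I)) (((quasiSplit (↥(maximalRealSubfield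 L)) L (IsCMField.complexConj L) 2).toAdelic (weylLongU ((IsCMField.complexConj L : L ≃ₐ[↥(maximalRealSubfield L)] L) : L →+* L) (rfl : (StdForm.antidiagonal 2).over L = (StdForm.antidiagonal 2).over L))) * ((v : (quasiSplit (↥(maximalRealSubfield L)) L (IsCMField.complexConj L) 2).Adelic) * (k : (quasiSplit (↥(maximalRealSubfield L)) L (IsCMField.complexConj L) 2).Adelic))) ∂ν) ∂μK) * conj (mellin f (-conj ((σ₀ : ℂ) + t * I))))) =
      ∫ t : ℝ, mellin f (-((σ₀ : ℂ) + t * I)) * conj (mellin g (-conj ((σ₀ : ℂ) + t * I))) * conj ((((((ν 𝓕).toReal⁻¹ : ℝ)) : ℂ) * ∫ k : ((standardMaximalCompactGL 2 L).comap (adelicVal (↥(maximalRealSubfield L)) L (IsCMField.complexConj L) 2 ((StdForm.antidiagonal 2).over L)) : Subgroup (quasiSplit (↥(maximalRealSubfield L)) L (IsCMField.complexConj L) 2).Adelic), φb (k : (quasiSplit (↥(maximalRealSubfield L)) L (IsCMField.complexConj L) 2).Adelic) * conj (∫ v : ↥(adelicUnipotent (↥(maximalRealSubfield L)) L (IsCMField.complexConj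 L) 2), flatSectionU φa ((σ₀ : ℂ) + t * I) (((quasiSplit (↥(maximalRealSubfield L)) L (IsCMField.complexConj L) 2).toAdelic (weylLongU ((IsCMField.complexConj L : L ≃ₐ[↥(maximalRealSubfield L)] L) : L →+* L) (rfl : (StdForm.antidiagonal 2).over L = (StdForm.antidiagonal 2).over L))) * ((v : (quasiSplit (↥(maximalRealSubfield L)) L (IsCMField.complexConj L) 2).Adelic) * (k : (quasiSplit (↥(maximalRealSubfield L)) L (IsCMField.complexConj L) 2).Adelic))) ∂ν) ∂μK)) := by
    rw [← integral_conj, ← integral_neg_eq_self]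
    refine integral_congr_ae (ae_of_all _ fun t => ?_)
    dsimp only
    rw [hneg t, Complex.conj_conj]
    simp only [map_mul, Complex.conj_conj]
    ring
  calc ∫ t : ℝ, mellin f (-((σ₀ : ℂ) + t * I)) * conj (mellin g (-conj ((σ₀ : ℂ) + t * I))) * (((((ν 𝓕).toReal⁻¹ : ℝ)) : ℂ) * ∫ k : ((standardMaximalCompactGL 2 L).comap (adelicVal (↥(maximalRealSubfield L)) L (IsCMField.complexConj L) 2 ((StdForm.antidiagonal 2).over L)) : Subgroup (quasiSplit (↥(maximalRealSubfield L)) L (IsCMField.complexConj L) 2).Adelic), φa (k : (quasiSplit (↥(maximalRealSubfield L)) L (IsCMField.complexConj L) 2).Adelic) * conj (∫ v : ↥(adelicUnipotent (↥(maximalRealSubfield L)) L (IsCMField.complexConj L) 2), flatSectionU φb (conj ((σ₀ : ℂ) + t * I)) (((quasiSplit (↥(maximalRealSubfield L)) L (IsCMField.complexConj L) 2).toAdelic (weylLongU ((IsCMField.complexConj L : L ≃ₐ[↥(maximalRealSubfield L)] L) : L →+* L) (rfl : (StdForm.antidiagonal 2).over L = (StdForm.antidiagonal 2).over L))) * ((v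 : (quasiSplit (↥(maximalRealSubfield L)) L (IsCMField.complexConj L) 2).Adelic) * (k : (quasiSplit (↥(maximalRealSubfield L)) L (IsCMField.complexConj L) 2).Adelic))) ∂ν) ∂μK)
      = ∫ t : ℝ, mellin f (-((σ₀ : ℂ) + t * I)) * ((((((ν 𝓕).toReal⁻¹ : ℝ)) : ℂ) * ∫ k : ((standardMaximalCompactGL 2 L).comap (adelicVal (↥(maximalRealSubfield L)) L (IsCMField.complexConj L) 2 ((StdForm.antidiagonal 2).over L)) : Subgroup (quasiSplit (↥(maximalRealSubfield L)) L (IsCMField.complexConj L) 2).Adelic), φa (k : (quasiSplit (↥(maximalRealSubfield L)) L (IsCMField.complexConj L) 2).Adelic) * conj (∫ v : ↥(adelicUnipotent (↥(maximalRealSubfield L)) L (IsCMField.complexConj L) 2), flatSectionU φb (conj ((σ₀ : ℂ) + t * I)) (((quasiSplit (↥(maximalRealSubfield L)) L (IsCMField.complexConj L) 2).toAdelic (weylLongU ((IsCMField.complexConj L : L ≃ₐ[↥(maximalRealSubfield L)] L) : L →+* L) (rfl : (StdForm.antidiagonal 2).over L = (StdForm.antidiagonal 2).over L))) * ((v : (quasiSplit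 (↥(maximalRealSubfield L)) L (IsCMField.complexConj L) 2).Adelic) * (k : (quasiSplit (↥(maximalRealSubfield L)) L (IsCMField.complexConj L) 2).Adelic))) ∂ν) ∂μK) * conj (mellin g (-conj ((σ₀ : ℂ) + t * I)))) := integral_congr_ae (ae_of_all _ fun t => by ring)
    _ = conj (∫ t : ℝ, mellin g (-((σ₀ : ℂ) + t * I)) * ((((((ν 𝓕).toReal⁻¹ : ℝ)) : ℂ) * ∫ k : ((standardMaximalCompactGL 2 L).comap (adelicVal (↥(maximalRealSubfield L)) L (IsCMField.complexConj L) 2 ((StdForm.antidiagonal 2).over L)) : Subgroup (quasiSplit (↥(maximalRealSubfield L)) L (IsCMField.complexConj L) 2).Adelic), φb (k : (quasiSplit (↥(maximalRealSubfield L)) L (IsCMField.complexConj L) 2).Adelic) * conj (∫ v : ↥(adelicUnipotent (↥(maximalRealSubfield L)) L (IsCMField.complexConj L) 2), flatSectionU φa (conj ((σ₀ : ℂ) + t * I)) (((quasiSplit (↥(maximalRealSubfield L)) L (IsCMField.complexConj L) 2).toAdelic (weylLongU ((IsCMField.complexConj L : L ≃ₐ[↥(maximalRealSubfield L)] L) :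 L →+* L) (rfl : (StdForm.antidiagonal 2).over L = (StdForm.antidiagonal 2).over L))) * ((v : (quasiSplit (↥(maximalRealSubfield L)) L (IsCMField.complexConj L) 2).Adelic) * (k : (quasiSplit (↥(maximalRealSubfield L)) L (IsCMField.complexConj L) 2).Adelic))) ∂ν) ∂μK) * conj (mellin f (-conj ((σ₀ : ℂ) + t * I))))) := by rw [hkey, Complex.conj_conj]
    _ = _ := hflip

end Summit.HodgeConjecture.HodgeConjecture.Cruxes.H413.K2E1ChiPseudoEisensteinHermitianLineIdentityCMTwo

end
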